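import Summits.ResolutionOfSingularities.ResolutionOfSingularities.Theorems.UniversalCellsCampaignW82PrimeFieldTransferLinks
import Summits.ResolutionOfSingularities.ResolutionOfSingularities.Theorems.UniformComplexityCampaignW82AlgClosureFgKernelLinks
import Summits.ResolutionOfSingularities.ResolutionOfSingularities.Theorems.UniversalCellsCampaignW82SmoothTwistGradedProofs
import HarnessLib

/-!
# [OURS · L1 W8.2] Both door cruxes hang on the SMOOTH-TWIST step BY NAME; the summit implies it — links

Cell `res-hironaka`, LADDER-RESOLUTION rung L (RESCUE), slot W8.2; prover res-L1-s82-pv-1 (gen 2). Leaf file in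
the existing Theses-importing cones of Theorems/UniversalCellsCampaignW82PrimeFieldTransferLinks.lean (door 1,
`Theses.UniversalCells`) and Theorems/UniformComplexityCampaignW82AlgClosureFgKernelLinks.lean (door 2,
`Theses.UniformComplexity`); pure logic on top of the Theses-free equivalence
`CampaignW82.perfectionStepAt_iff_smoothTwistStepAt` (Theorems/UniversalCellsCampaignW82SmoothTwistGradedProofs.lean).

WHAT IS PROVED (no new mathematics; by-name rewiring):
* `primeFieldToPerfect_of_forall_smoothTwistStepDimLe_top` — the crux `UniversalCells.PrimeFieldToPerfect`
  (stmt-ResolutionOfSingularities-15233) follows from `SmoothTwistStepDimLe p ⊤` at every prime `p`: «for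
  every perfect `M` of characteristic `p` with resolution over `RatFunc M`, every irreducible geometrically
  reduced variety over a finite level `M(t^{1/p^e})` acquires a SMOOTH proper birational model after finitely
  many more `p`-th roots of `t`».
* `primeModelTransfer_of_forall_smoothTwistStepDimLe_top` — the crux `UniformComplexity.PrimeModelTransfer`
  (stmt-ResolutionOfSingularities-8933) follows from the same; and
  `primeModelTransfer_of_forall_smoothTwistStepAt_algClosureFg_top` — it already follows from the smooth-twist
  step at the countably many constant fields `M = (𝔽_p(s))^{alg} ∩ K` (door 2's sharpest residual, p475047 /
  res-L1-s82-pv-2's p476882, in smooth-twist form).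
* `perfectionStepAt_of_resolutionInChar`, `smoothTwistStepAt_of_resolutionInChar` — conversely every instance
  of either step at a constant field of characteristic `p` follows from the summit statement
  `ResolutionInChar p` (the «never trivially false» line of the statement file, kernel-checked); so on the
  slot's normal form the summit, the perfection step and the smooth-twist step stand or fall together at `⊤`.

HONEST FRAMING. OURS work of the rescue rung; NOT a statement of the manuscript ([Hironaka2017] §17 ¶2 /
§2 p.4 is the role replaced, see the statement file p481193); no external premise; AI work, weaker than expert
review.
-/

noncomputable section

set_option linter.dupNamespace false -- mandated namespace of this single-conjunct summit

open _root_.CategoryTheory _root_.CategoryTheory.Limits _root_.AlgebraicGeometry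
open Literature.AlgebraicGeometry.Resolution

namespace Summit.ResolutionOfSingularities.ResolutionOfSingularities.Theorems.CampaignW82

/-! ## The cruxes from the smooth-twist step -/

/-- **Door 1 hangs on the smooth-twist step**: `UniversalCells.PrimeFieldToPerfect`
(stmt-ResolutionOfSingularities-15233) follows from `SmoothTwistStepDimLe p ⊤` at every prime `p`
(`perfectionStepDimLe_of_smoothTwistStepDimLe` + `primeFieldToPerfect_of_forall_perfectionStepDimLe_top`).
[folklore] -/
theorem primeFieldToPerfect_of_forall_smoothTwistStepDimLe_top
    (h : ∀ p : ℕ, p.Prime → SmoothTwistStepDimLe p ⊤) :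
    Summit.ResolutionOfSingularities.ResolutionOfSingularities.Theses.UniversalCells.PrimeFieldToPerfect :=
  primeFieldToPerfect_of_forall_perfectionStepDimLe_top fun p hp =>
    perfectionStepDimLe_of_smoothTwistStepDimLe (h p hp)

/-- **Door 2 hangs on the smooth-twist step (perfect constant fields)**: `UniformComplexity.PrimeModelTransfer`
(stmt-ResolutionOfSingularities-8933) follows from `SmoothTwistStepDimLe p ⊤` at every prime `p`. [folklore] -/
theorem primeModelTransfer_of_forall_smoothTwistStepDimLe_top
    (h : ∀ p : ℕ, p.Prime → SmoothTwistStepDimLe p ⊤) :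
    Summit.ResolutionOfSingularities.ResolutionOfSingularities.Theses.UniformComplexity.PrimeModelTransfer :=
  primeModelTransfer_of_forall_perfectionStepDimLe_top fun p hp =>
    perfectionStepDimLe_of_smoothTwistStepDimLe (h p hp)

/-- **Door 2, sharpest form**: `UniformComplexity.PrimeModelTransfer` already follows from the smooth-twist
step at `⊤` at the countably many constant fields `M = (𝔽_p(s))^{alg} ∩ K` (`K` algebraically closed of
characteristic `p`, `s ⊆ K` finite) — res-L1-s82-pv-2's closer
`primeModelTransfer_of_forall_perfectionStepAlgClosureFgDimLe_top` read through
`perfectionStepAlgClosureFgDimLe_iff_forall_smoothTwistStepAt`. [folklore] -/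
theorem primeModelTransfer_of_forall_smoothTwistStepAt_algClosureFg_top
    (h : ∀ p : ℕ, p.Prime → ∀ (K : Type) [Field K] [CharP K p] [IsAlgClosed K] (s : Finset K),
      SmoothTwistStepAt (algebraicClosure (Subfield.closure (↑s : Set K)) K) ⊤) :
    Summit.ResolutionOfSingularities.ResolutionOfSingularities.Theses.UniformComplexity.PrimeModelTransfer :=
  primeModelTransfer_of_forall_perfectionStepAlgClosureFgDimLe_top fun p hp =>
    (perfectionStepAlgClosureFgDimLe_iff_forall_smoothTwistStepAt p ⊤).2 (h p hp)

/-! ## The summit implies both steps at every constant field of characteristic `p` -/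

/-- **Every instance of the perfection step follows from the summit**: `ResolutionInChar p` resolves every
reduced (in particular every integral) separated scheme of finite type over every field of characteristic `p`,
so over the perfect `L ⊇ RatFunc M` (`CharP L p` along the injective `RatFunc M → L`); the hypothesis over
`RatFunc M` and the grade are idle. (The «never trivially false» line of the statement file, kernel-checked.)
[folklore] -/
theorem perfectionStepAt_of_resolutionInChar {p : ℕ} (h : ResolutionInChar.{0} p) (M : Type) [Field M]
    [CharP M p] (n : WithBot ℕ∞) : PerfectionStepAt M n := by
  intro _ L _ _ _ _ X f hs hl hq hX _
  haveI : CharP L p := charP_of_injective_algebraMap (algebraMap (RatFunc M) L).injective p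
  exact h L X f hs hl hq inferInstance

/-- **Every instance of the smooth-twist step follows from the summit** (through the perfection step and the
descent theorem `smoothTwistStepAt_of_perfectionStepAt`): if `ResolutionInChar p` holds then over every finite
purely inseparable level over `RatFunc M` (`M` of characteristic `p`) every irreducible geometrically reduced
variety has a smooth proper birational model at a further finite level. [folklore] -/
theorem smoothTwistStepAt_of_resolutionInChar {p : ℕ} (h : ResolutionInChar.{0} p) (M : Type) [Field M]
    [CharP M p] (n : WithBot ℕ∞) : SmoothTwistStepAt M n :=
  smoothTwistStepAt_of_perfectionStepAt M (perfectionStepAt_of_resolutionInChar h M n)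

/-- Hence the door-1 graded smooth-twist step at every grade from the summit. [folklore] -/
theorem smoothTwistStepDimLe_of_resolutionInChar {p : ℕ} (h : ResolutionInChar.{0} p) (n : WithBot ℕ∞) :
    SmoothTwistStepDimLe p n :=
  fun M _ _ _ => smoothTwistStepAt_of_resolutionInChar h M n

end Summit.ResolutionOfSingularities.ResolutionOfSingularities.Theorems.CampaignW82

end
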